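import Summits.BirchSwinnertonDyer.BirchSwinnertonDyer.Theorems.RamifiedSevenEllipticUnitsFrameRamifiedValuation
import Summits.BirchSwinnertonDyer.BirchSwinnertonDyer.Theorems.RamifiedSevenEllipticUnitsRelativeValuation
import HarnessLib

set_option linter.dupNamespace false
set_option autoImplicit false

/-!
# K7r crux `EllipticUnitValueSevenOfGZK` (stmt-BirchSwinnertonDyer-19945), line `rubin-formula-zp` v3,
# stub S_relval — the transfer chain RE-BASED ON INTEGRAL-IMAGE EVALUATIONS INTO VALUED FIELDS
# (`K_𝔭 = 𝔭.adicCompletion K`; `ℚ̄_p`, `ℂ_[p]` in the companion file), with the O11-frame instance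
# and the `K_𝔭` ENDGAME «`λ₀ = ord_π ρ`, hence `l = ord_p r`» (pure valuation algebra; cell `bsd-cm`,
# seat `bsd-cm-k7r-c3` g9; helper, `--supports` 19945; companion of p485495 / p486296 / p488020)

HONEST FRAMING. Nothing here is about elliptic curves or `L`-functions; nothing is asserted about the
crux; BSD is not proved by any of this. The v3 stub S_relval (`X12.O11.RamifiedCMRelativeValuationAtZp`,
seat k7r-c4, p487655) is ram g9's RELATIVE RUBIN VALUATION THEOREM in conclusion form; its formal
chain (memo RELATIVE-RUBIN-ram-g9 §1 (vi)(i)(RR), THEOREM (2)/(3)/(4)) was proved by seat k7r-c3 g8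
(`…UltrametricTransfer` §2, `…RelativeValuation` §A) for evaluations `ev : R⟦X⟧ →+* S` into a
`v`-INTEGRAL ring (`∀ s, v s ≤ 1`: `ℤ_[p]`, `𝒪_𝔭`). But the FRAME lemma (F1) (`…FrameRamifiedValuation`,
p488020: `Valued.v (p : K_𝔭) = exp(−2)`, `Valued.v ((1+y)^{p^m} − 1) = exp(−(1+2m))`) and the values of
the [BKNO] interface (`EllipticUnitClassData.erl`: `((ι.symm z : PadicAlgCl p) : ℂ_[p])`) live in
FIELDS, where `∀ s, v s ≤ 1` is false. THIS FILE closes that currency gap, so that whichever value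
field the (T4) typing of [BKNO] Def. 4.7 / Thm. 4.12 chooses (tabled with bsd-littype-10), the transfer
is mechanical:
* §1 transfer from the single inequality `v (a − c) ≤ v x` (any valued commutative ring): (c), (c′),
  (a) `v x < v a → v c = v a`, (b) `v x < v c → v a = v c`.
* §2 INTEGRAL-IMAGE evaluations `ev : R⟦X⟧ →+* S`, `∀ G, v (ev G) ≤ 1` (implied by g8's hypothesis;
  automatic when `ev` factors through a subring of `{v ≤ 1}`): `v (ev F − ev (C (F 0))) ≤ v (ev X)` and
  the power-series transfers (a)/(b)/(c) + the unit-member step (v).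
* §3 the RELATIVE chain THEOREM (2)/(3)/(4) over §2, and the packaged form «`λ₀ = ord ρ`»:
  `map_constantCoeff_eq_of_interpolation_of_lt_of_integral` (`ev F · per = A₀ · ρ`, `ℓ₀ · per₀ = A₀`,
  `v per = v per₀` [(iv), hypothesis], `v ℓ₀ = 1` [(v)], `v (ev X) < v ρ` ⇒ `v (ev (C (F 0))) = v ρ`).
* §4 the threshold lemma from a SQUARE: `(v y)² = v p`, `p ≥ 5` ⇒ `v ((1+y)^{p^m} − 1) = (v y)^{1+2m}`
  (g8's `…_of_ramificationTwo` with `π := y`; the shape usable in `ℝ≥0`-valued currencies).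
* §5 the `K_𝔭` instance: integrality through `𝔭.adicCompletionIntegers K`; THEOREM (2) AT THE O11 FRAME
  for a field-valued `ev` (`ev X = u^{p^m} − 1`, `Valued.v (u − 1) = exp(−1)` [(F2), hypothesis]); and
  the `K_𝔭` ENDGAME `natCast_eq_padicValRat_of_interpolation_of_isFrame`: with `ρ² = r ∈ ℚ^×`,
  `padicValRat p r < 1 + 2m` and the bottom reading `Valued.v (ev (C (F 0))) = exp(−l)` [Thm 7.2 at 𝟙,
  hypothesis], `(l : ℤ) = padicValRat p r` — LITERALLY the conclusion of S_relval.
Every [BKNO]-dependent object (𝓛 = `F`, the evaluation `ev`, `u = φ_ac(γ)`, the periods `per`, `per₀`,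
the algebraic values `A₀`, `ρ`, the bottom exponent `l`) is a HYPOTHESIS about ring elements; inputs
(iii) Thm 4.12, (iv) D-independence of periods, (v) unit member, Thm 7.2 at 𝟙, (F2) are hypotheses;
nothing is constructed; no statement item is filed.
References: [BKNO] arXiv:2608.06879 Def. 4.7, Thm. 4.12, Thm. 7.2 (shapes only)
[BurungaleKobayashiNakamuraOta2026]; J.-P. Serre, *Local Fields* (1979) Ch. II §1, Ch. XIV §4 Prop. 9
[Serre1979]; L. Washington, *Introduction to Cyclotomic Fields* (1997) §7.2 [Washington1997];
J. Neukirch, *Algebraic Number Theory* (1999) Ch. II §4, (4.8), Ch. III (2.12) [NeukirchANT1999];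
memo RELATIVE-RUBIN-ram-g9.md §1; cell STATUS D123/D127/D128.
-/

noncomputable section

namespace Summit.BirchSwinnertonDyer.BirchSwinnertonDyer.Theorems.RamifiedSevenEllipticUnits.Ultrametric

open PowerSeries IsDedekindDomain IsDedekindDomain.HeightOneSpectrum NumberField
  Literature.NumberTheory.EllipticCurves Literature.NumberTheory.EllipticCurves.Rank1Residual

/-! ## §1 Transfer from the inequality `v (a − c) ≤ v x` (any valued ring; fields included) -/

section SubLe

variable {S : Type*} [CommRing S] {Γ₀ : Type*} [LinearOrderedCommGroupWithZero Γ₀]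
  (v : Valuation S Γ₀)

/-- **(c) `v (a − c) ≤ v x → v a ≤ max (v c) (v x)`** («`ord F(x) ≥ min(ord F(0), ord x)`»); no
integrality of `S` is needed once the inequality is given. [cite: Serre1979, Ch. II §1] -/
theorem map_le_max_of_map_sub_le {x a c : S} (h : v (a - c) ≤ v x) : v a ≤ max (v c) (v x) :=
  calc v a = v (c + (a - c)) := by rw [add_sub_cancel]
    _ ≤ max (v c) (v (a - c)) := v.map_add _ _
    _ ≤ max (v c) (v x) := max_le_max le_rfl h

/-- **(c′) `v (a − c) ≤ v x → v c ≤ max (v a) (v x)`**. [cite: Serre1979, Ch. II §1] -/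
theorem map_const_le_max_of_map_sub_le {x a c : S} (h : v (a - c) ≤ v x) :
    v c ≤ max (v a) (v x) :=
  calc v c = v (a - (a - c)) := by rw [sub_sub_cancel]
    _ ≤ max (v a) (v (a - c)) := v.map_sub _ _
    _ ≤ max (v a) (v x) := max_le_max le_rfl h

/-- **(a) `v (a − c) ≤ v x`, `v x < v a` ⇒ `v c = v a`** («`ord F(x) < ord x ⇒ ord F(0) = ord F(x)`»).
[cite: Serre1979, Ch. II §1] -/
theorem map_const_eq_of_map_sub_le_of_lt {x a c : S} (h : v (a - c) ≤ v x) (hlt : v x < v a) :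
    v c = v a := by
  have hε : v (a - c) < v a := lt_of_le_of_lt h hlt
  calc v c = v (a - (a - c)) := by rw [sub_sub_cancel]
    _ = v a := v.map_sub_eq_of_lt_left hε

/-- **(b) `v (a − c) ≤ v x`, `v x < v c` ⇒ `v a = v c`** («`ord F(0) < ord x ⇒ ord F(x) = ord F(0)`»).
[cite: Serre1979, Ch. II §1] -/
theorem map_eq_const_of_map_sub_le_of_lt {x a c : S} (h : v (a - c) ≤ v x) (hlt : v x < v c) :
    v a = v c := by
  have hε : v (a - c) < v c := lt_of_le_of_lt h hlt
  calc v a = v (c + (a - c)) := by rw [add_sub_cancel]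
    _ = v c := v.map_add_eq_of_lt_left hε

end SubLe

/-! ## §2 INTEGRAL-IMAGE evaluations `ev : R⟦X⟧ →+* S` (`∀ G, v (ev G) ≤ 1`) into a valued ring -/

section IntegralEval

variable {S : Type*} [CommRing S] {Γ₀ : Type*} [LinearOrderedCommGroupWithZero Γ₀]
  (v : Valuation S Γ₀) {R : Type*} [CommRing R]

/-- g8's hypothesis (`S` is `v`-integral) implies the integral-image hypothesis for every `ev`.
[cite: Serre1979, Ch. II §1] -/
theorem forall_map_eval_le_one_of_forall_map_le_one (hS : ∀ s : S, v s ≤ 1) (ev : R⟦X⟧ →+* S) :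
    ∀ G : R⟦X⟧, v (ev G) ≤ 1 :=
  fun G ↦ hS (ev G)

/-- An evaluation that factors through a ring `T` mapped into `{v ≤ 1}` has integral image (e.g.
`T = 𝒪_𝔭 → K_𝔭`, `T = ℤ_[p] → ℂ_[p]`). [cite: Serre1979, Ch. II §1] -/
theorem forall_map_comp_le_one {T : Type*} [CommRing T] (f : T →+* S) (hf : ∀ t : T, v (f t) ≤ 1)
    (ev₀ : R⟦X⟧ →+* T) : ∀ G : R⟦X⟧, v ((f.comp ev₀) G) ≤ 1 :=
  fun G ↦ hf (ev₀ G)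

/-- An evaluation that factors through a SUBRING of `{v ≤ 1}` has integral image.
[cite: Serre1979, Ch. II §1] -/
theorem forall_map_subtype_comp_le_one (A : Subring S) (hA : ∀ a ∈ A, v a ≤ 1)
    (ev₀ : R⟦X⟧ →+* A) : ∀ G : R⟦X⟧, v ((A.subtype.comp ev₀) G) ≤ 1 :=
  fun G ↦ hA _ (ev₀ G).2

/-- **`v (ev F − ev (C (F 0))) ≤ v (ev X)` for an integral-image evaluation** («`F(x) − F(0) ∈ x·𝒪`»
read valuatively in the value FIELD): `F − C(F 0) = X · G` in `R⟦X⟧` and `v (ev G) ≤ 1`.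
[cite: Washington1997, §7.2] -/
theorem map_eval_sub_eval_C_le (ev : R⟦X⟧ →+* S) (hint : ∀ G : R⟦X⟧, v (ev G) ≤ 1) (F : R⟦X⟧) :
    v (ev F - ev (C (constantCoeff F))) ≤ v (ev X) := by
  obtain ⟨G, hG⟩ := X_dvd_sub_C_constantCoeff F
  have h : ev F - ev (C (constantCoeff F)) = ev X * ev G := by rw [← map_sub, hG, map_mul]
  rw [h, map_mul]
  calc v (ev X) * v (ev G) ≤ v (ev X) * 1 := mul_le_mul_right (hint G) _
    _ = v (ev X) := mul_one _

/-- **TRANSFER (a), field-valued**: `v (ev X) < v (ev F) → v (ev (C (F 0))) = v (ev F)`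
(«`ord_π 𝓛(ξ) < ord_π(ξ(γ) − 1) ⇒ ord_π 𝓛(𝟙) = ord_π 𝓛(ξ)`»). [cite: Washington1997, §7.2] -/
theorem map_eval_C_constantCoeff_eq_of_lt_of_integral (ev : R⟦X⟧ →+* S)
    (hint : ∀ G : R⟦X⟧, v (ev G) ≤ 1) (F : R⟦X⟧) (hlt : v (ev X) < v (ev F)) :
    v (ev (C (constantCoeff F))) = v (ev F) :=
  map_const_eq_of_map_sub_le_of_lt v (map_eval_sub_eval_C_le v ev hint F) hlt

/-- **TRANSFER (b), field-valued**: `v (ev X) < v (ev (C (F 0))) → v (ev F) = v (ev (C (F 0)))`.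
[cite: Washington1997, §7.2] -/
theorem map_eval_eq_of_lt_of_integral (ev : R⟦X⟧ →+* S) (hint : ∀ G : R⟦X⟧, v (ev G) ≤ 1)
    (F : R⟦X⟧) (hlt : v (ev X) < v (ev (C (constantCoeff F)))) :
    v (ev F) = v (ev (C (constantCoeff F))) :=
  map_eq_const_of_map_sub_le_of_lt v (map_eval_sub_eval_C_le v ev hint F) hlt

/-- **TRANSFER (c), field-valued**: `v (ev F) ≤ max (v (ev (C (F 0)))) (v (ev X))` and symmetrically.
[cite: Washington1997, §7.2] -/
theorem map_eval_le_max_of_integral (ev : R⟦X⟧ →+* S) (hint : ∀ G : R⟦X⟧, v (ev G) ≤ 1)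
    (F : R⟦X⟧) :
    v (ev F) ≤ max (v (ev (C (constantCoeff F)))) (v (ev X)) ∧
      v (ev (C (constantCoeff F))) ≤ max (v (ev F)) (v (ev X)) :=
  ⟨map_le_max_of_map_sub_le v (map_eval_sub_eval_C_le v ev hint F),
    map_const_le_max_of_map_sub_le v (map_eval_sub_eval_C_le v ev hint F)⟩

/-- **UNIT MEMBER (v), field-valued**: if the constant term is a unit (`v (ev (C (F 0))) = 1`) and the
evaluation point is topologically nilpotent (`v (ev X) < 1`) then every value is a unit:
`v (ev F) = 1` («`𝓛_{D₀} ∈ Λ^× ⇒ ord_π 𝓛_{D₀}(ξ) = 0`»). [cite: Washington1997, §7.2] -/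
theorem map_eval_eq_one_of_constantCoeff_of_integral (ev : R⟦X⟧ →+* S)
    (hint : ∀ G : R⟦X⟧, v (ev G) ≤ 1) (F : R⟦X⟧) (h1 : v (ev (C (constantCoeff F))) = 1)
    (hX : v (ev X) < 1) : v (ev F) = 1 := by
  have hlt : v (ev X) < v (ev (C (constantCoeff F))) := by rwa [h1]
  rw [map_eval_eq_of_lt_of_integral v ev hint F hlt, h1]

end IntegralEval

/-! ## §3 The RELATIVE chain (2)/(3)/(4) over integral-image evaluations, and «`λ₀ = ord ρ`» -/

section RelativeIntegral

variable {S : Type*} [CommRing S] {Γ₀ : Type*} [LinearOrderedCommGroupWithZero Γ₀]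
  (v : Valuation S Γ₀) {R : Type*} [CommRing R]

/-- **THEOREM (2), field-valued** (memo §1 THEOREM (2)): for an integral-image `ev`, GIVEN
`ev F · per = A` [(iii) at the member], `ℓ₀ · per₀ = A₀` [(iii) at the base], `v per = v per₀` [(iv)],
`v ℓ₀ = 1` [(v)]: `v (ev X) · v A₀ < v A ⇒ v (ev (C (F 0))) · v A₀ = v A` («`v < 1 + 2m ⇒ λ₀ = v`»).
[cite: BurungaleKobayashiNakamuraOta2026, Thm. 4.12 and Def. 4.7 (arXiv:2608.06879 pp. 27, 32) (claim; preprint; shape only)] -/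
theorem map_constantCoeff_mul_eq_of_interpolation_of_lt_of_integral (ev : R⟦X⟧ →+* S)
    (hint : ∀ G : R⟦X⟧, v (ev G) ≤ 1) (F : R⟦X⟧) {ℓ₀ per per₀ A A₀ : S} (hD : ev F * per = A)
    (hD₀ : ℓ₀ * per₀ = A₀) (hper : v per = v per₀) (hunit : v ℓ₀ = 1)
    (hlt : v (ev X) * v A₀ < v A) : v (ev (C (constantCoeff F))) * v A₀ = v A := by
  rw [map_eval_C_constantCoeff_eq_of_lt_of_integral v ev hint F
    (map_lt_of_interpolation v hD hD₀ hper hunit hlt)]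
  exact map_mul_eq_of_interpolation v hD hD₀ hper hunit

/-- **THEOREM (3), field-valued**: if instead `v (ev X) < v (ev (C (F 0)))` («`λ₀ < 1 + 2m`») then
again `v (ev (C (F 0))) · v A₀ = v A`. [cite: BurungaleKobayashiNakamuraOta2026, Thm. 4.12 and Def. 4.7 (arXiv:2608.06879 pp. 27, 32) (claim; preprint; shape only)] -/
theorem map_constantCoeff_mul_eq_of_interpolation_of_lt_constantCoeff_of_integral (ev : R⟦X⟧ →+* S)
    (hint : ∀ G : R⟦X⟧, v (ev G) ≤ 1) (F : R⟦X⟧) {ℓ₀ per per₀ A A₀ : S} (hD : ev F * per = A)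
    (hD₀ : ℓ₀ * per₀ = A₀) (hper : v per = v per₀) (hunit : v ℓ₀ = 1)
    (hlt : v (ev X) < v (ev (C (constantCoeff F)))) :
    v (ev (C (constantCoeff F))) * v A₀ = v A := by
  rw [← map_eval_eq_of_lt_of_integral v ev hint F hlt]
  exact map_mul_eq_of_interpolation v hD hD₀ hper hunit

/-- **THEOREM (4), field-valued**: unconditionally `v A ≤ max (v (ev (C (F 0)))) (v (ev X)) · v A₀`.
[cite: BurungaleKobayashiNakamuraOta2026, Thm. 4.12 and Def. 4.7 (arXiv:2608.06879 pp. 27, 32) (claim; preprint; shape only)] -/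
theorem map_le_max_mul_of_interpolation_of_integral (ev : R⟦X⟧ →+* S)
    (hint : ∀ G : R⟦X⟧, v (ev G) ≤ 1) (F : R⟦X⟧) {ℓ₀ per per₀ A A₀ : S} (hD : ev F * per = A)
    (hD₀ : ℓ₀ * per₀ = A₀) (hper : v per = v per₀) (hunit : v ℓ₀ = 1) :
    v A ≤ max (v (ev (C (constantCoeff F)))) (v (ev X)) * v A₀ := by
  rw [← map_mul_eq_of_interpolation v hD hD₀ hper hunit]
  exact mul_le_mul_left ((map_eval_le_max_of_integral v ev hint F).1) _

/-- **«`λ₀ = ord_π ρ`» (the relative valuation formula, packaged)**: write the member's algebraic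
value as `A = A₀ · ρ` (`ρ = ι⁻¹(L_W/L_{W₀})` up to the period normalisation; `v A₀ ≠ 0`). GIVEN
`ev F · per = A₀ · ρ`, `ℓ₀ · per₀ = A₀`, `v per = v per₀` [(iv)], `v ℓ₀ = 1` [(v)] and the threshold
`v (ev X) < v ρ` («`ord_π ρ < ord_π(ξ(γ) − 1) = 1 + 2m`»): `v (ev (C (F 0))) = v ρ`.
[cite: BurungaleKobayashiNakamuraOta2026, Thm. 4.12 and Def. 4.7 (arXiv:2608.06879 pp. 27, 32) (claim; preprint; shape only)] -/
theorem map_constantCoeff_eq_of_interpolation_of_lt_of_integral (ev : R⟦X⟧ →+* S)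
    (hint : ∀ G : R⟦X⟧, v (ev G) ≤ 1) (F : R⟦X⟧) {ℓ₀ per per₀ A₀ ρ : S}
    (hD : ev F * per = A₀ * ρ) (hD₀ : ℓ₀ * per₀ = A₀) (hper : v per = v per₀) (hunit : v ℓ₀ = 1)
    (hA₀ : v A₀ ≠ 0) (hlt : v (ev X) < v ρ) : v (ev (C (constantCoeff F))) = v ρ := by
  have hlt' : v (ev X) * v A₀ < v (A₀ * ρ) := by
    rw [map_mul, mul_comm (v (ev X))]
    exact mul_lt_mul_of_pos_left hlt (zero_lt_iff.2 hA₀)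
  have h2 := map_constantCoeff_mul_eq_of_interpolation_of_lt_of_integral v ev hint F hD hD₀ hper
    hunit hlt'
  rw [map_mul, mul_comm (v A₀)] at h2
  exact mul_right_cancel₀ hA₀ h2

/-- The same on a `v`-integral `S` (g8's hypothesis shape). [cite: BurungaleKobayashiNakamuraOta2026, Thm. 4.12 and Def. 4.7 (arXiv:2608.06879 pp. 27, 32) (claim; preprint; shape only)] -/
theorem map_constantCoeff_eq_of_interpolation_of_lt (hS : ∀ s : S, v s ≤ 1) (ev : R⟦X⟧ →+* S)
    (F : R⟦X⟧) {ℓ₀ per per₀ A₀ ρ : S} (hD : ev F * per = A₀ * ρ) (hD₀ : ℓ₀ * per₀ = A₀)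
    (hper : v per = v per₀) (hunit : v ℓ₀ = 1) (hA₀ : v A₀ ≠ 0) (hlt : v (ev X) < v ρ) :
    v (ev (C (constantCoeff F))) = v ρ :=
  map_constantCoeff_eq_of_interpolation_of_lt_of_integral v ev
    (forall_map_eval_le_one_of_forall_map_le_one v hS ev) F hD hD₀ hper hunit hA₀ hlt

end RelativeIntegral

/-! ## §4 The threshold from a square: `(v y)² = v p`, `p ≥ 5` ⇒ `v ((1+y)^{p^m} − 1) = (v y)^{1+2m}` -/

section SqThreshold

variable {S : Type*} [CommRing S] {Γ₀ : Type*} [LinearOrderedCommGroupWithZero Γ₀]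
  (v : Valuation S Γ₀)

/-- **Threshold lemma, square form**: for a prime `p ≥ 5` with `0 < v p < 1` and `y` with
`(v y)² = v p` (ramification index `2`: `ord(y) = ½·ord(p)`, e.g. `y = φ_ac(γ) − 1`), for every `m`:
`v ((1 + y)^(p^m) − 1) = (v y)^(1 + 2m)`. (g8's `…_of_ramificationTwo` with `π := y`; this is the
form consumed in `ℝ≥0`-valued currencies, where `v p = 1/p` has the square root `p^{−1/2}`.)
[cite: Serre1979, Ch. XIV §4, Prop. 9 (proof)] -/
theorem map_one_add_pow_prime_pow_sub_one_of_sq_eq {p : ℕ} (hp : p.Prime) (h5 : 5 ≤ p) {y : S}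
    (hp0 : v (p : S) ≠ 0) (hp1 : v (p : S) < 1) (hy : v y ^ 2 = v (p : S)) (m : ℕ) :
    v ((1 + y) ^ (p ^ m) - 1) = v y ^ (1 + 2 * m) := by
  have hy0 : v y ≠ 0 := by
    intro h
    apply hp0
    rw [← hy, h, zero_pow two_ne_zero]
  have hy1 : v y < 1 := by
    by_contra hle
    rw [not_lt] at hle
    have h1 : (1 : Γ₀) ≤ v y ^ 2 := by
      calc (1 : Γ₀) = 1 ^ 2 := (one_pow 2).symm
        _ ≤ v y ^ 2 := pow_le_pow_left₀ zero_le hle 2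
    rw [hy] at h1
    exact not_lt.2 h1 hp1
  exact map_one_add_pow_prime_pow_sub_one_of_ramificationTwo v hp h5 hy0 hy1 hy.symm rfl m

end SqThreshold

/-! ## §5 The `K_𝔭` instance: integrality through `𝒪_𝔭`, THEOREM (2) at the O11 frame, ENDGAME -/

section AdicCompletion

variable {K : Type} [Field K] [NumberField K] (𝔭 : HeightOneSpectrum (𝓞 K)) {R : Type*} [CommRing R]

/-- An evaluation `R⟦X⟧ → 𝒪_𝔭 ↪ K_𝔭` (through `𝔭.adicCompletionIntegers K`) has integral image.
[cite: NeukirchANT1999, Ch. II §4 (the valuation ring of a completion)] -/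
theorem forall_valued_le_one_of_adicCompletionIntegers
    (ev₀ : R⟦X⟧ →+* 𝔭.adicCompletionIntegers K) :
    ∀ G : R⟦X⟧, Valued.v (((𝔭.adicCompletionIntegers K).subtype.comp ev₀) G) ≤ 1 :=
  fun G ↦ (mem_adicCompletionIntegers (R := 𝓞 K) K 𝔭).1 (ev₀ G).2

end AdicCompletion

section FrameTransfer

open WeierstrassCurve Summit.BirchSwinnertonDyer.Rank1Residual.X12.O11

variable {W : WeierstrassCurve ℚ} [W.IsElliptic] [W.IsGloballyMinimal] {p : ℕ} [hp : Fact p.Prime]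
  {K : Type} [Field K] [NumberField K] {𝔭 : HeightOneSpectrum (𝓞 K)}
  {W' : WeierstrassCurve ℚ} {vc : VariableChange ℚ} {R : Type*} [CommRing R]

omit [W.IsGloballyMinimal] in
/-- **The evaluation point of the de Rham character `ξ_{p^m} = φ_ac^{p^m}` AT THE O11 FRAME**: if
`ev X = u^{p^m} − 1` with `ord_𝔭(u − 1) = 1` (`Valued.v (u − 1) = exp(−1)`, the hypothesis (F2) on the
generator `u = φ_ac(γ)` of `N¹ ∩ (1 + 𝔭)`), then `Valued.v (ev X) = exp(−(1 + 2m))` (by (F1),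
`valued_one_add_pow_prime_pow_sub_one_of_isFrame`). [cite: Serre1979, Ch. XIV §4, Prop. 9 (proof)] -/
theorem valued_eval_X_eq_of_isFrame (hF : IsFrame W p K 𝔭 W' vc)
    (ev : R⟦X⟧ →+* 𝔭.adicCompletion K) {u : 𝔭.adicCompletion K}
    (hu : Valued.v (u - 1) = WithZero.exp (-1)) {m : ℕ} (hX : ev X = u ^ (p ^ m) - 1) :
    Valued.v (ev X) = WithZero.exp (-(1 + 2 * (m : ℤ))) := by
  rw [hX, ← valued_one_add_pow_prime_pow_sub_one_of_isFrame hF hu m, add_sub_cancel]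

omit [W.IsGloballyMinimal] in
/-- **THEOREM (2) AT THE O11 FRAME, field-valued** (`S = K_𝔭`): for an integral-image evaluation
`ev : R⟦X⟧ →+* K_𝔭` at `ev X = u^{p^m} − 1` with (F2) `Valued.v (u − 1) = exp(−1)`, GIVEN the two
interpolation identities [(iii)], `v per = v per₀` [(iv)], `v ℓ₀ = 1` [(v)]:
`exp(−(1+2m)) · v A₀ < v A ⇒ v (ev (C (F 0))) · v A₀ = v A` («`ord_π ρ < 1 + 2m ⇒ λ₀ = ord_π ρ`»).
[cite: BurungaleKobayashiNakamuraOta2026, Thm. 4.12 and Def. 4.7 (arXiv:2608.06879 pp. 27, 32) (claim; preprint; shape only)] -/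
theorem valued_constantCoeff_mul_eq_of_interpolation_of_isFrame (hF : IsFrame W p K 𝔭 W' vc)
    (ev : R⟦X⟧ →+* 𝔭.adicCompletion K) (hint : ∀ G : R⟦X⟧, Valued.v (ev G) ≤ 1) (F : R⟦X⟧)
    {u ℓ₀ per per₀ A A₀ : 𝔭.adicCompletion K} {m : ℕ} (hu : Valued.v (u - 1) = WithZero.exp (-1))
    (hX : ev X = u ^ (p ^ m) - 1) (hD : ev F * per = A) (hD₀ : ℓ₀ * per₀ = A₀)
    (hper : Valued.v per = Valued.v per₀) (hunit : Valued.v ℓ₀ = 1)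
    (hlt : WithZero.exp (-(1 + 2 * (m : ℤ))) * Valued.v A₀ < Valued.v A) :
    Valued.v (ev (C (constantCoeff F))) * Valued.v A₀ = Valued.v A := by
  rw [← valued_eval_X_eq_of_isFrame hF ev hu hX] at hlt
  exact map_constantCoeff_mul_eq_of_interpolation_of_lt_of_integral Valued.v ev hint F hD hD₀ hper
    hunit hlt

omit [W.IsGloballyMinimal] in
/-- **THE `K_𝔭` ENDGAME — the conclusion of S_relval from typed inputs, all as hypotheses about
elements of `K_𝔭`.** At the O11 frame, for an integral-image evaluation `ev : R⟦X⟧ →+* K_𝔭` of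
`F = 𝓛_W` at `ev X = u^{p^m} − 1`, (F2) `Valued.v (u − 1) = exp(−1)`, the interpolation identities
`ev F · per = A₀ · ρ` (member) and `ℓ₀ · per₀ = A₀` (unit base, `A₀ ≠ 0`) [(iii)], `v per = v per₀`
[(iv)], `v ℓ₀ = 1` [(v)], the relative value `ρ` with `ρ² = r ∈ ℚ^×` (`r = (L_W/L_{W₀})²`, the v3
currency), the threshold `padicValRat p r < 1 + 2m`, and the bottom reading `Valued.v (ev (C (F 0))) =
exp(−l)` [Thm 7.2 at 𝟙 with the unit bottom period]: **`(l : ℤ) = padicValRat p r`** — literally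
S_relval's conclusion. [cite: BurungaleKobayashiNakamuraOta2026, Thm. 4.12, Def. 4.7 and Thm. 7.2 (arXiv:2608.06879 pp. 27, 32, 41) (claim; preprint; shape only)] -/
theorem natCast_eq_padicValRat_of_interpolation_of_isFrame (hF : IsFrame W p K 𝔭 W' vc)
    (ev : R⟦X⟧ →+* 𝔭.adicCompletion K) (hint : ∀ G : R⟦X⟧, Valued.v (ev G) ≤ 1) (F : R⟦X⟧)
    {u ℓ₀ per per₀ A₀ ρ : 𝔭.adicCompletion K} {m l : ℕ} {r : ℚ}
    (hu : Valued.v (u - 1) = WithZero.exp (-1)) (hX : ev X = u ^ (p ^ m) - 1)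
    (hD : ev F * per = A₀ * ρ) (hD₀ : ℓ₀ * per₀ = A₀) (hper : Valued.v per = Valued.v per₀)
    (hunit : Valued.v ℓ₀ = 1) (hA₀ : A₀ ≠ 0) (hr : r ≠ 0)
    (hρ : ρ ^ 2 = ((r : K) : 𝔭.adicCompletion K)) (hlt : padicValRat p r < 1 + 2 * (m : ℤ))
    (hbottom : Valued.v (ev (C (constantCoeff F))) = WithZero.exp (-(l : ℤ))) :
    (l : ℤ) = padicValRat p r := by
  have hvρ : Valued.v ρ = WithZero.exp (-padicValRat p r) :=
    valued_eq_of_sq_eq_ratCast_of_isFrame hF hr hρ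
  have hA₀' : Valued.v A₀ ≠ 0 := (Valuation.ne_zero_iff _).2 hA₀
  have hlt' : Valued.v (ev X) < Valued.v ρ := by
    rw [valued_eval_X_eq_of_isFrame hF ev hu hX, hvρ, WithZero.exp_lt_exp]
    linarith
  have h := map_constantCoeff_eq_of_interpolation_of_lt_of_integral Valued.v ev hint F hD hD₀ hper
    hunit hA₀' hlt'
  rw [hbottom, hvρ, WithZero.exp_inj] at h
  linarith

end FrameTransfer

end Summit.BirchSwinnertonDyer.BirchSwinnertonDyer.Theorems.RamifiedSevenEllipticUnits.Ultrametric

end
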